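import Mathlib
import Summits.HodgeConjecture.HodgeConjecture.Theorems.WeilClassTestFormatFiveThreeCrossPlusTwoPieceDefs
import Summits.HodgeConjecture.HodgeConjecture.Theorems.WeilClassTestFormatFiveThreeCrossPlusTwoPieceExits
import Summits.HodgeConjecture.HodgeConjecture.Theorems.WeilClassTestFormatFiveThreeCrossPlusTwoFaceInfinity
import Summits.HodgeConjecture.HodgeConjecture.Theorems.WeilClassTestFormatFiveThreeCrossPlusOneEndpoint

/-!
# Conjecture N (hodge-weil ladder, GAPS G51b), format (5,3): CROSS + TWO FREE E-ROOTS — THE k = 2 EE PIECE: `N ≥ 0` (t-endpoint assembly)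

Prover 2, generation 28 (note `run/shared/lean/b2b/hodge-weil/b2b-hweil-pv2-g28/DC2-CLOSED-G28.md`, ADDENDUM C). **THE EE PIECE OF THE k = 2 STRATUM.**
In the charge-gap coordinates `(m,t,a1,a2,u1,u2)` of the piece `{h_p = 0}` (pv2-g23 §3, pv2-g24 `CROSSPLUS3-G24.md` §1; `b_i = a_i − t + u_i`; named polynomials
`pDelta`, `pQc`, `pH`, `pN` of `…CrossPlusTwoPieceDefs`): if `m > 0`, `a_i ≥ 0`, `b_i ≥ 0`, `Δ > 0`, `Qc ≥ 0` (`M1 = Qc/Δ ≥ 0`) and `H ≤ 0` (`h_m ≥ 0`), then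
**`N ≥ 0`** (`(m+a1+a2)Δ·G = 4mN`, so `G = Q₂ + Q₄ ≥ 0` there) — `piece_EE_nonneg`.

PROOF (pv2-g24's t-ENDPOINT REDUCTION, here kernel-checked): for `u = 0`, `N ≡ 0` (`pN_u_zero`). Otherwise `N` is a concave quadratic in `t`
(`pN_quadratic`, leading coefficient `−m(a1u1² + a2u2²) ≤ 0`), the window `p(s) = (a1+u1−s)(s−T)` (with `T` from `…CrossPlusTwoFaceInfinity.H_pos_eventually`:
`H > 0` for `s ≤ T`) and the constraint `q(s) = min(b2(s), Δ(s), Qc(s), −H(s))` are as in pv2-g22's `…CrossPlusOneEndpoint.endpoint_principle`; at `p = 0`: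
`b1 = 0` (`exit_b1` / `exit_delta`) or `s = T` (impossible: `H(T) > 0`); at `q = 0`: `b2 = 0` / `Δ = 0` / `Qc = 0` / `H = 0` (`exit_b2` / `exit_delta` / `exit_Qc` /
`exit_H` of `…CrossPlusTwoPieceExits`, the last one being the double corner (L-H)). The five exits: (L-b) pv2-g24 `…CrossPlusTwoFaceB`, (L-Q) `…CrossPlusTwoFaces`,
(L-Δ) `…CrossPlusTwoFaceDelta`, (L-∞) `…CrossPlusTwoFaceInfinity`, (L-H) `…DoubleCornerPsatz`/`…DoubleCornerClosed` (pv2-g27/28, COMPUTATIONAL: this theorem inherits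
`Lean.ofReduceBool`). NOT claimed here: the translation of the reduced k = 2 EE system (variables `X1 … b2`, `h_p = 0`) INTO these coordinates (every such point with
`X1 > 0` is a piece point with `Δ > 0`, pv2-g24 §1's elementary estimate) — stated for the successor; nor the EF/FF pieces.
Nothing here is a case of HC, a rung or a door edge; no statement of Markman's papers is used. New cell result ⇒ Summits/.
-/

set_option linter.dupNamespace false
set_option maxRecDepth 16384

namespace Summit.HodgeConjecture.HodgeConjecture.WeilClassTestFormatFiveThreeCrossPlusTwoPiece

open Summit.HodgeConjecture.HodgeConjecture.WeilClassTestFormatFiveThreeCrossPlusTwoPieceDefs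
open Summit.HodgeConjecture.HodgeConjecture.WeilClassTestFormatFiveThreeCrossPlusTwoPieceExits (exit_b1 exit_b2 exit_Qc exit_H exit_delta)
open Summit.HodgeConjecture.HodgeConjecture.WeilClassTestFormatFiveThreeCrossPlusTwoFaceInfinity (H_pos_eventually)
open Summit.HodgeConjecture.HodgeConjecture.WeilClassTestFormatFiveThreeCrossPlusOneEndpoint (endpoint_principle)

set_option maxHeartbeats 4000000 in
/-- `H > 0` for `s ≤ T` in terms of the named polynomial `pH` (from `H_pos_eventually`, whose `H` is the sliced form). -/
theorem pH_pos_eventually (m a1 a2 u1 u2 : ℝ) (hm : (0:ℝ) < m) (ha1 : (0:ℝ) ≤ a1) (ha2 : (0:ℝ) ≤ a2) (hu : u1 ≠ 0 ∨ u2 ≠ 0) :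
    ∃ T : ℝ, ∀ s : ℝ, s ≤ T → (0:ℝ) < pH m s a1 a2 u1 u2 := by
  obtain ⟨T, hT⟩ := H_pos_eventually m a1 a2 u1 u2 hm ha1 ha2 hu
  refine ⟨T, fun s hs => ?_⟩
  have h := hT s hs
  rw [pH_eq]
  exact h.trans_eq (by ring)

set_option maxHeartbeats 4000000 in
/-- **THE k = 2 EE PIECE OF REAL CONJECTURE N IN FORMAT (5,3).** On the piece `{h_p = 0}` of the 'cross + two free E-roots' stratum, in charge-gap coordinates:
`m > 0`, `a_i ≥ 0`, `b_i = a_i − t + u_i ≥ 0`, `Δ > 0`, `Qc ≥ 0`, `H ≤ 0` ⟹ `N ≥ 0`. -/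
theorem piece_EE_nonneg (m t a1 a2 u1 u2 : ℝ) (hm : (0:ℝ) < m) (ha1 : (0:ℝ) ≤ a1) (ha2 : (0:ℝ) ≤ a2)
    (hb1 : (0:ℝ) ≤ a1 - t + u1) (hb2 : (0:ℝ) ≤ a2 - t + u2)
    (hD : (0:ℝ) < pDelta m t a1 a2) (hQ : (0:ℝ) ≤ pQc m t a1 a2 u1 u2) (hH : pH m t a1 a2 u1 u2 ≤ (0:ℝ)) :
    (0:ℝ) ≤ pN m t a1 a2 u1 u2 := by
  by_cases hu : u1 = 0 ∧ u2 = 0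
  · obtain ⟨rfl, rfl⟩ := hu
    exact (pN_u_zero m t a1 a2).ge
  · have hu' : u1 ≠ 0 ∨ u2 ≠ 0 := not_and_or.mp hu
    obtain ⟨T, hT⟩ := pH_pos_eventually m a1 a2 u1 u2 hm ha1 ha2 hu'
    have htT : T < t := not_le.mp fun h => by have := hT t h; linarith
    -- the two boundary clauses of the endpoint principle
    have hP : ∀ s : ℝ, (fun s : ℝ => (a1 + u1 - s) * (s - T)) s = 0 → (0:ℝ) ≤ (fun s : ℝ => min (a2 - s + u2) (min (pDelta m s a1 a2) (min (pQc m s a1 a2 u1 u2) (-(pH m s a1 a2 u1 u2))))) s →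
        (0:ℝ) ≤ (fun s : ℝ => pN m s a1 a2 u1 u2) s := by
      intro s hps hqs
      change (a1 + u1 - s) * (s - T) = 0 at hps
      change (0:ℝ) ≤ min (a2 - s + u2) (min (pDelta m s a1 a2) (min (pQc m s a1 a2 u1 u2) (-(pH m s a1 a2 u1 u2)))) at hqs
      change (0:ℝ) ≤ pN m s a1 a2 u1 u2
      simp only [le_min_iff] at hqs
      obtain ⟨hb2s, hDs, hQs, hHs⟩ := hqs
      have hHs' : pH m s a1 a2 u1 u2 ≤ 0 := by linarith
      rcases mul_eq_zero.mp hps with h1 | h2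
      · rcases hDs.eq_or_lt with hD0 | hDp
        · exact exit_delta m s a1 a2 u1 u2 hm ha1 ha2 (by linarith) hb2s hD0.symm hQs hHs'
        · exact exit_b1 m s a1 a2 u1 u2 hm ha1 ha2 (by linarith) hb2s hDp hQs hHs' (by linarith)
      · have hsT : s ≤ T := by linarith
        have := hT s hsT
        linarith
    have hQ' : ∀ s : ℝ, (fun s : ℝ => min (a2 - s + u2) (min (pDelta m s a1 a2) (min (pQc m s a1 a2 u1 u2) (-(pH m s a1 a2 u1 u2))))) s = 0 → (0:ℝ) ≤ (fun s : ℝ => (a1 + u1 - s) * (s - T)) s →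
        (0:ℝ) ≤ (fun s : ℝ => pN m s a1 a2 u1 u2) s := by
      intro s hqs hps
      change min (a2 - s + u2) (min (pDelta m s a1 a2) (min (pQc m s a1 a2 u1 u2) (-(pH m s a1 a2 u1 u2)))) = 0 at hqs
      change (0:ℝ) ≤ (a1 + u1 - s) * (s - T) at hps
      change (0:ℝ) ≤ pN m s a1 a2 u1 u2
      have hall : (0:ℝ) ≤ min (a2 - s + u2) (min (pDelta m s a1 a2) (min (pQc m s a1 a2 u1 u2) (-(pH m s a1 a2 u1 u2)))) :=
        le_of_eq hqs.symm
      simp only [le_min_iff] at hall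
      obtain ⟨hb2s, hDs, hQs, hHs⟩ := hall
      have hHs' : pH m s a1 a2 u1 u2 ≤ 0 := by linarith
      have hsT : T < s := not_le.mp fun h => by have := hT s h; linarith
      have hb1s : (0:ℝ) ≤ a1 - s + u1 := by
        have h0 : (0:ℝ) ≤ a1 + u1 - s := (mul_nonneg_iff_of_pos_right (sub_pos.mpr hsT)).mp hps
        linarith
      rcases hDs.eq_or_lt with hD0 | hDp
      · exact exit_delta m s a1 a2 u1 u2 hm ha1 ha2 hb1s hb2s hD0.symm hQs hHs'
      rcases min_eq_iff.mp hqs with ⟨hb2z, _⟩ | ⟨hrest, _⟩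
      · exact exit_b2 m s a1 a2 u1 u2 hm ha1 ha2 hb1s hb2s hDp hQs hHs' (by linarith)
      rcases min_eq_iff.mp hrest with ⟨hDz, _⟩ | ⟨hrest2, _⟩
      · exact absurd hDz hDp.ne'
      rcases min_eq_iff.mp hrest2 with ⟨hQz, _⟩ | ⟨hHz, _⟩
      · exact exit_Qc m s a1 a2 u1 u2 hm ha1 ha2 hb1s hb2s hDp hQs hHs' hQz
      · exact exit_H m s a1 a2 u1 u2 hm ha1 ha2 hb1s hb2s hDp hQs hHs' (by linarith)
    have hcont : Continuous (fun s : ℝ => min (a2 - s + u2) (min (pDelta m s a1 a2) (min (pQc m s a1 a2 u1 u2) (-(pH m s a1 a2 u1 u2))))) := by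
      have h1 : Continuous fun s : ℝ => a2 - s + u2 := by fun_prop
      have h2 := continuous_pDelta m a1 a2
      have h3 := continuous_pQc m a1 a2 u1 u2
      have h4 : Continuous fun s : ℝ => -(pH m s a1 a2 u1 u2) := (continuous_pH m a1 a2 u1 u2).neg
      exact h1.min (h2.min (h3.min h4))
    have key := endpoint_principle (fun s : ℝ => pN m s a1 a2 u1 u2) (fun s : ℝ => (a1 + u1 - s) * (s - T)) (fun s : ℝ => min (a2 - s + u2) (min (pDelta m s a1 a2) (min (pQc m s a1 a2 u1 u2) (-(pH m s a1 a2 u1 u2)))))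
      (-(m * (a1 * u1^(2:ℕ) + a2 * u2^(2:ℕ)))) ((3:ℝ)*a1*a2*u2^(3:ℕ) - (3:ℝ)*a1*a2*u1*u2^(2:ℕ) - (3:ℝ)*a1*a2*u1^(2:ℕ)*u2 + (3:ℝ)*a1*a2*u1^(3:ℕ) - (4:ℝ)*a1*a2^(2:ℕ)*u1*u2 - (2:ℝ)*a1*a2^(2:ℕ)*u1^(2:ℕ) - (2:ℝ)*a1^(2:ℕ)*a2*u2^(2:ℕ) - (4:ℝ)*a1^(2:ℕ)*a2*u1*u2 + (3:ℝ)*m*a2*u2^(3:ℕ) + (3:ℝ)*m*a1*u1^(3:ℕ) - (6:ℝ)*m*a1*a2*u1*u2) ((12:ℝ)*a1*a2^(2:ℕ)*u1^(2:ℕ)*u2 - (6:ℝ)*a1*a2^(2:ℕ)*u1^(3:ℕ) + (4:ℝ)*a1*a2^(3:ℕ)*u1^(2:ℕ) - (6:ℝ)*a1^(2:ℕ)*a2*u2^(3:ℕ) + (12:ℝ)*a1^(2:ℕ)*a2*u1*u2^(2:ℕ) + (4:ℝ)*a1^(2:ℕ)*a2^(2:ℕ)*u1*u2 + (4:ℝ)*a1^(3:ℕ)*a2*u2^(2:ℕ)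 - (9:ℝ)*m*a1*a2*u2^(3:ℕ) + (9:ℝ)*m*a1*a2*u1*u2^(2:ℕ) + (9:ℝ)*m*a1*a2*u1^(2:ℕ)*u2 - (9:ℝ)*m*a1*a2*u1^(3:ℕ) + (6:ℝ)*m*a1*a2^(2:ℕ)*u1^(2:ℕ) + (6:ℝ)*m*a1^(2:ℕ)*a2*u2^(2:ℕ) - (3:ℝ)*m^(2:ℕ)*a2*u2^(3:ℕ) - (3:ℝ)*m^(2:ℕ)*a1*u1^(3:ℕ) + (4:ℝ)*m^(2:ℕ)*a1*a2*u2^(2:ℕ) - (2:ℝ)*m^(2:ℕ)*a1*a2*u1*u2 + (4:ℝ)*m^(2:ℕ)*a1*a2*u1^(2:ℕ) + m^(3:ℕ)*a2*u2^(2:ℕ) + m^(3:ℕ)*a1*u1^(2:ℕ)) (a1 + u1 + T) (-((a1 + u1) * T))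
      (neg_nonpos.mpr (mul_nonneg hm.le (by positivity)))
      (fun s => pN_quadratic m s a1 a2 u1 u2)
      (fun s => by show (a1 + u1 - s) * (s - T) = _; ring)
      hcont hP hQ' t (show (0:ℝ) ≤ (a1 + u1 - t) * (t - T) from mul_nonneg (by linarith) (sub_nonneg.mpr htT.le))
      (show (0:ℝ) ≤ min (a2 - t + u2) (min (pDelta m t a1 a2) (min (pQc m t a1 a2 u1 u2) (-(pH m t a1 a2 u1 u2)))) from
        le_min hb2 (le_min hD.le (le_min hQ (neg_nonneg.mpr hH))))
    exact key

end Summit.HodgeConjecture.HodgeConjecture.WeilClassTestFormatFiveThreeCrossPlusTwoPiece
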